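import Mathlib
import Literature.Analysis.FluidPDE.VectorCalculus
import Literature.Analysis.ODE.GlobalExistence

/-!
# `SkeletonEquilibrium` (stmt-NavierStokesRegularity-15400), line `Sketch`: forced shooting

Tools stub `stub_forcedShooting` of the lead skeleton: well-posedness of the SHOOTING map of the
frozen-field filament equation. In the rotating Leray frame each rescaled filament solves the
unit-speed "Lorentz-force" equation `X″ = η X′ × (A X + U(t))` with the drift
`A y = ½ y − α e₃ × y` (`e₃ = EuclideanSpace.single 2 1`) and a frozen continuous forcing `U`.
For Cauchy data `(P, e)`, `‖e‖ = 1`, we prove global existence on `ℝ` of a `C²` unit-speed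
solution and its uniqueness among `C²` curves with the same data.

Proof: the phase-space field `(x, w) ↦ (w, B w (A x + U t))` (`B w v = η w × v`) on `ℝ³ × ℝ³`
is `C¹`, hence Lipschitz on balls uniformly for `t` in compact intervals, and continuous in `t`;
the speed `‖w‖` is conserved (`⟪B w v, w⟫ = 0`), whence the a priori bound `‖x t‖ ≤ ‖P‖ + t`;
the tree's continuation principle `Literature.Analysis.ODE.exists_solution_of_apriori_bound` gives
a solution on `[0, ∞)`, the time-reversed system gives one on `(-∞, 0]`, and the two are glued
at `0` (`solution_append`). Uniqueness is Grönwall's (`ODE_solution_unique_of_mem_Ioo`) for the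
phase curves `(X, X′)`. The phase-space lemmas are written for a general finite-dimensional real
inner product space `F` and a continuous bilinear `B` with `⟪B w v, w⟫ = 0`.
-/

noncomputable section

namespace Summit.NavierStokesRegularity.NavierStokesRegularity.Theorems.SkeletonEquilibrium.Sketch
set_option linter.dupNamespace false

open Set Metric Filter Topology
open Literature.Analysis.FluidPDE Literature.Analysis.ODE
open scoped RealInnerProductSpace InnerProductSpace NNReal

variable {F : Type*} [NormedAddCommGroup F] [InnerProductSpace ℝ F]

/-- `⟪a × b, a⟫ = 0`: a cross product is orthogonal to its first factor (coordinate expansion of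
Mathlib's `crossProduct` transported to `EuclideanSpace ℝ (Fin 3)`). [folklore] -/
private theorem inner_cross_self_left (a b : EuclideanSpace ℝ (Fin 3)) : ⟪cross a b, a⟫ = 0 := by
  simp only [cross, PiLp.inner_apply, RCLike.inner_apply, conj_trivial, Fin.sum_univ_three,
    cross_apply, Matrix.cons_val_zero, Matrix.cons_val_one, Matrix.cons_val_two,
    Matrix.head_cons, Matrix.tail_cons]
  ring

/-- The frozen phase-space field `(x, w) ↦ (w, B w (A x + u))` (`B` continuous bilinear, `A`
continuous linear) is Lipschitz on every ball, uniformly for `‖u‖ ≤ M`: it is `C¹` jointly in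
`((x, w), u)`, so its derivative is bounded on the compact convex set `B̄(0, ρ) × B̄(0, M)` and the
mean value inequality applies. [folklore] -/
private theorem lipschitz_field [ProperSpace F] (B : F →L[ℝ] F →L[ℝ] F) (A : F →L[ℝ] F)
    (M ρ : ℝ) : ∃ K : ℝ≥0, ∀ u : F, ‖u‖ ≤ M →
      LipschitzOnWith K (fun p : F × F => (p.2, B p.2 (A p.1 + u))) (closedBall 0 ρ) := by
  have hΦ : ContDiff ℝ 1 (fun q : (F × F) × F => (q.1.2, B q.1.2 (A q.1.1 + q.2))) := by
    fun_prop
  have hS : IsCompact (closedBall (0 : F × F) ρ ×ˢ closedBall (0 : F) M) :=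
    (isCompact_closedBall _ _).prod (isCompact_closedBall _ _)
  obtain ⟨C, hC⟩ := hS.exists_bound_of_continuousOn
    (hΦ.continuous_fderiv one_ne_zero).continuousOn
  have hL := Convex.lipschitzOnWith_of_nnnorm_fderiv_le (𝕜 := ℝ) (C := Real.toNNReal C)
    (fun q _ => hΦ.differentiable one_ne_zero q)
    (fun q hq => by
      rw [← NNReal.coe_le_coe, coe_nnnorm]
      exact (hC q hq).trans (Real.le_coe_toNNReal C))
    ((convex_closedBall _ _).prod (convex_closedBall _ _))
  refine ⟨Real.toNNReal C, fun u hu => LipschitzOnWith.of_dist_le_mul fun p hp q hq => ?_⟩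
  have hu' : u ∈ closedBall (0 : F) M := mem_closedBall_zero_iff.2 hu
  have h := hL.dist_le_mul (p, u) ⟨hp, hu'⟩ (q, u) ⟨hq, hu'⟩
  rwa [@Prod.dist_eq _ _ _ _ (p, u) (q, u), dist_self, max_eq_left dist_nonneg] at h

/-- **A priori bounds.** Along any solution `(x, w)` on `[0, s]` of the phase-space system
`x' = w`, `w' = B w (A x + U t)` with `⟪B w v, w⟫ = 0`, issued from `(P, e)` with `‖e‖ = 1`, the
speed is conserved, `‖w t‖ = 1` (`(‖w‖²)' = 2 ⟪w, B w ·⟫ = 0`), and `‖x t‖ ≤ ‖P‖ + t` (mean value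
inequality). [folklore] -/
private theorem apriori {B : F →L[ℝ] F →L[ℝ] F} (hB : ∀ w v, ⟪B w v, w⟫ = 0) {A : F →L[ℝ] F}
    {U : ℝ → F} {P e : F} (he : ‖e‖ = 1) {s : ℝ} {γ : ℝ → F × F} (h0 : γ 0 = (P, e))
    (hγ : ∀ t ∈ Icc 0 s,
      HasDerivWithinAt γ ((γ t).2, B (γ t).2 (A (γ t).1 + U t)) (Icc 0 s) t) :
    ∀ t ∈ Icc 0 s, ‖(γ t).2‖ = 1 ∧ ‖(γ t).1‖ ≤ ‖P‖ + t := by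
  have h1 : ∀ t ∈ Icc 0 s, HasDerivWithinAt (fun τ => (γ τ).1) (γ t).2 (Icc 0 s) t :=
    fun t ht => (ContinuousLinearMap.fst ℝ F F).hasFDerivAt.comp_hasDerivWithinAt t (hγ t ht)
  have h2 : ∀ t ∈ Icc 0 s,
      HasDerivWithinAt (fun τ => (γ τ).2) (B (γ t).2 (A (γ t).1 + U t)) (Icc 0 s) t :=
    fun t ht => (ContinuousLinearMap.snd ℝ F F).hasFDerivAt.comp_hasDerivWithinAt t (hγ t ht)
  -- conservation of the speed
  have hsq : ∀ t ∈ Icc 0 s, HasDerivWithinAt (fun τ => ‖(γ τ).2‖ ^ 2) 0 (Icc 0 s) t := by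
    intro t ht
    refine (h2 t ht).norm_sq.congr_deriv ?_
    rw [real_inner_comm, hB, mul_zero]
  have hunit : ∀ t ∈ Icc 0 s, ‖(γ t).2‖ = 1 := by
    intro t ht
    have h := norm_image_sub_le_of_norm_deriv_le_segment' (f' := fun _ => (0 : ℝ)) (C := 0) hsq
      (fun _ _ => norm_zero.le) t ht
    simp only [zero_mul, norm_le_zero_iff, sub_eq_zero, h0, he, one_pow] at h
    exact (pow_left_inj₀ (norm_nonneg _) zero_le_one two_ne_zero).1 (by rw [h, one_pow])
  refine fun t ht => ⟨hunit t ht, ?_⟩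
  have h := norm_image_sub_le_of_norm_deriv_le_segment' (C := 1) h1
    (fun τ hτ => (hunit τ (Ico_subset_Icc_self hτ)).le) t ht
  simp only [h0, sub_zero, one_mul] at h
  calc ‖(γ t).1‖ = ‖((γ t).1 - P) + P‖ := by rw [sub_add_cancel]
    _ ≤ ‖(γ t).1 - P‖ + ‖P‖ := norm_add_le _ _
    _ ≤ ‖P‖ + t := by linarith

/-- **Forward global existence.** For continuous `U` the phase-space system `x' = w`,
`w' = B w (A x + U t)` (`⟪B w v, w⟫ = 0`) has a solution on `[0, ∞)` from any `(P, e)` with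
`‖e‖ = 1`: the field is Lipschitz on balls uniformly on compact time intervals (`lipschitz_field`,
`U` bounded there), continuous in `t`, and solutions obey the a priori bound
`‖(x, w)‖ ≤ ‖P‖ + T + 1` (`apriori`), so the continuation principle
`exists_solution_of_apriori_bound` applies. [folklore] -/
private theorem exists_forward [ProperSpace F] {B : F →L[ℝ] F →L[ℝ] F}
    (hB : ∀ w v, ⟪B w v, w⟫ = 0) (A : F →L[ℝ] F) {U : ℝ → F} (hU : Continuous U) (P : F)
    {e : F} (he : ‖e‖ = 1) :
    ∃ γ : ℝ → F × F, γ 0 = (P, e) ∧ ∀ T, ∀ t ∈ Icc 0 T,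
      HasDerivWithinAt γ ((γ t).2, B (γ t).2 (A (γ t).1 + U t)) (Icc 0 T) t := by
  refine exists_solution_of_apriori_bound
    (v := fun t (p : F × F) => (p.2, B p.2 (A p.1 + U t))) ?_ ?_ ?_
  · intro T ρ
    obtain ⟨M, hM⟩ :=
      isCompact_Icc.exists_bound_of_continuousOn (hU.continuousOn (s := Icc 0 T))
    obtain ⟨K, hK⟩ := lipschitz_field B A M ρ
    exact ⟨K, fun t ht => hK (U t) (hM t ht)⟩
  · intro p
    exact (by fun_prop : Continuous fun t => (p.2, B p.2 (A p.1 + U t))).continuousOn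
  · intro T hT
    refine ⟨‖P‖ + T + 1, ?_, fun s hs γ h0 hγ t ht => ?_⟩
    · rw [Prod.norm_mk, he]
      exact max_le (by linarith) (by linarith [norm_nonneg P])
    · obtain ⟨hw, hx⟩ := apriori hB he h0 hγ t ht
      rw [Prod.norm_def, hw]
      exact max_le (by linarith [ht.2, hs.2]) (by linarith [norm_nonneg P])

/-- **Time reversal.** If `β = (x, w)` solves the phase-space system with parameters
`(-B, U(-·))` on `[0, T]`, then `s ↦ (x(-s), -w(-s))` solves the system with parameters `(B, U)`
on `[-T, 0]` (chain rule with `s ↦ -s`, then the linear map `(x, w) ↦ (x, -w)`). [folklore] -/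
private theorem reverse {B : F →L[ℝ] F →L[ℝ] F} {A : F →L[ℝ] F} {U : ℝ → F} {T : ℝ}
    {β : ℝ → F × F} (hβ : ∀ τ ∈ Icc 0 T,
      HasDerivWithinAt β ((β τ).2, (-B) (β τ).2 (A (β τ).1 + U (-τ))) (Icc 0 T) τ) :
    ∀ t ∈ Icc (-T) 0, HasDerivWithinAt (fun s => (((β (-s)).1, -(β (-s)).2) : F × F))
      (-(β (-t)).2, B (-(β (-t)).2) (A (β (-t)).1 + U t)) (Icc (-T) 0) t := by
  intro t ht
  have hmaps : MapsTo Neg.neg (Icc (-T) 0) (Icc 0 T) := fun s hs =>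
    ⟨neg_nonneg.2 hs.2, neg_le.2 hs.1⟩
  set L : F × F →L[ℝ] F × F :=
    (ContinuousLinearMap.fst ℝ F F).prod (-ContinuousLinearMap.snd ℝ F F) with hL
  have h1 := (hβ (-t) (hmaps ht)).scomp t (hasDerivAt_neg t).hasDerivWithinAt hmaps
  have h2 := L.hasFDerivAt.comp_hasDerivWithinAt t h1
  have hfun : (fun s => (((β (-s)).1, -(β (-s)).2) : F × F)) = L ∘ (β ∘ Neg.neg) := by
    funext s
    simp [hL]
  rw [hfun]
  refine h2.congr_deriv ?_
  simp [hL]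

/-- **Two-sided global phase curve.** For continuous `U`, `⟪B w v, w⟫ = 0` and `‖e‖ = 1` there
is a global phase curve `γ = (x, w) : ℝ → F × F` with `γ 0 = (P, e)`, unit speed `‖w‖ ≡ 1`, and
`γ' t = (w, B w (A x + U t))` at every `t ∈ ℝ`: the forward solution (`exists_forward`) and the
reversed forward solution of the reversed system (`reverse`) glued at `0` (`solution_append`).
[folklore] -/
private theorem exists_phase [ProperSpace F] {B : F →L[ℝ] F →L[ℝ] F}
    (hB : ∀ w v, ⟪B w v, w⟫ = 0) (A : F →L[ℝ] F) {U : ℝ → F} (hU : Continuous U) (P : F)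
    {e : F} (he : ‖e‖ = 1) :
    ∃ γ : ℝ → F × F, γ 0 = (P, e) ∧ (∀ t, ‖(γ t).2‖ = 1) ∧
      ∀ t, HasDerivAt γ ((γ t).2, B (γ t).2 (A (γ t).1 + U t)) t := by
  obtain ⟨α, hα0, hα⟩ := exists_forward hB A hU P he
  have he' : ‖-e‖ = 1 := by rw [norm_neg, he]
  have hB' : ∀ w v, ⟪(-B) w v, w⟫ = 0 := fun w v => by
    rw [_root_.neg_apply, _root_.neg_apply, inner_neg_left, hB, neg_zero]
  obtain ⟨β, hβ0, hβ⟩ :=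
    exists_forward hB' A (U := fun t => U (-t)) (hU.comp continuous_neg) P he'
  set βr : ℝ → F × F := fun s => ((β (-s)).1, -(β (-s)).2) with hβr
  refine ⟨fun s => if s ≤ 0 then βr s else α s, by simp [hβr, hβ0], fun t => ?_, fun t => ?_⟩
  · by_cases ht : t ≤ 0
    · simp only [if_pos ht, hβr, norm_neg]
      exact ((apriori hB' he' hβ0 (hβ (-t))) (-t) ⟨neg_nonneg.2 ht, le_rfl⟩).1
    · simp only [if_neg ht]
      exact ((apriori hB he hα0 (hα t)) t ⟨(not_le.1 ht).le, le_rfl⟩).1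
  · have hT : 0 < |t| + 1 := by positivity
    have hsol := solution_append (v := fun t (p : F × F) => (p.2, B p.2 (A p.1 + U t)))
      (reverse (hβ (|t| + 1))) (hα (|t| + 1)) (by linarith) hT.le (by simp [hβ0, hα0])
    exact solution_hasDerivAt (v := fun t (p : F × F) => (p.2, B p.2 (A p.1 + U t))) hsol
      ⟨by linarith [neg_abs_le t], by linarith [le_abs_self t]⟩

/-- **From a phase curve to a `C²` curve.** If `γ = (x, w)` has `γ' t = (w, B w (A x + U t))`
at every `t`, with `U` continuous, then `x` is `C²`, `x' = w` and `x″ = B w (A x + U)`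
(`contDiff_succ_iff_deriv` twice; `x″` is a continuous expression in `x, w, U`). [folklore] -/
private theorem curve_of_phase {B : F →L[ℝ] F →L[ℝ] F} {A : F →L[ℝ] F} {U : ℝ → F}
    (hU : Continuous U) {γ : ℝ → F × F}
    (hγ : ∀ t, HasDerivAt γ ((γ t).2, B (γ t).2 (A (γ t).1 + U t)) t) :
    ContDiff ℝ 2 (fun s => (γ s).1) ∧ deriv (fun s => (γ s).1) = (fun t => (γ t).2) ∧
      ∀ t, deriv (deriv fun s => (γ s).1) t = B (γ t).2 (A (γ t).1 + U t) := by
  have hγc : Continuous γ := continuous_iff_continuousAt.2 fun t => (hγ t).continuousAt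
  have hXd : ∀ t, HasDerivAt (fun s => (γ s).1) (γ t).2 t := fun t =>
    (ContinuousLinearMap.fst ℝ F F).hasFDerivAt.comp_hasDerivAt t (hγ t)
  have hWd : ∀ t, HasDerivAt (fun s => (γ s).2) (B (γ t).2 (A (γ t).1 + U t)) t := fun t =>
    (ContinuousLinearMap.snd ℝ F F).hasFDerivAt.comp_hasDerivAt t (hγ t)
  have hd1 : deriv (fun s => (γ s).1) = fun t => (γ t).2 := funext fun t => (hXd t).deriv
  have hd2 : deriv (fun s => (γ s).2) = fun t => B (γ t).2 (A (γ t).1 + U t) :=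
    funext fun t => (hWd t).deriv
  refine ⟨?_, hd1, fun t => by rw [hd1, hd2]⟩
  rw [show (2 : WithTop ℕ∞) = 1 + 1 from one_add_one_eq_two.symm, contDiff_succ_iff_deriv,
    hd1, contDiff_one_iff_deriv, hd2]
  exact ⟨fun t => (hXd t).differentiableAt, by simp, fun t => (hWd t).differentiableAt,
    by fun_prop⟩

/-- **Uniqueness.** Two `C²` curves with the same Cauchy data at `0` solving
`Z″ = B Z′ (A Z + U)` coincide: their phase curves `(Z, Z′)` solve the same first-order system,
whose field is Lipschitz on a ball containing both curves over `[-T, T]` (compactness), so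
Grönwall uniqueness (`ODE_solution_unique_of_mem_Ioo`) applies on every `(-T, T)`. [folklore] -/
private theorem unique_of_phase [ProperSpace F] {B : F →L[ℝ] F →L[ℝ] F} {A : F →L[ℝ] F}
    {U : ℝ → F} (hU : Continuous U) {X Y : ℝ → F} (hX : ContDiff ℝ 2 X) (hY : ContDiff ℝ 2 Y)
    (h0 : X 0 = Y 0) (h0' : deriv X 0 = deriv Y 0)
    (hXo : ∀ t, deriv (deriv X) t = B (deriv X t) (A (X t) + U t))
    (hYo : ∀ t, deriv (deriv Y) t = B (deriv Y t) (A (Y t) + U t)) : X = Y := by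
  -- the phase curves solve the first-order system
  have key : ∀ {Z : ℝ → F}, ContDiff ℝ 2 Z →
      (∀ t, deriv (deriv Z) t = B (deriv Z t) (A (Z t) + U t)) →
      (Continuous fun s => (Z s, deriv Z s)) ∧
      ∀ t, HasDerivAt (fun s => (Z s, deriv Z s)) (deriv Z t, B (deriv Z t) (A (Z t) + U t)) t := by
    intro Z hZ hZo
    have hd : Differentiable ℝ Z := hZ.differentiable two_ne_zero
    have hd2 : Differentiable ℝ (deriv Z) := hZ.differentiable_deriv_two
    exact ⟨hd.continuous.prodMk hd2.continuous, fun t =>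
      ((hd t).hasDerivAt.prodMk (hd2 t).hasDerivAt).congr_deriv (by rw [hZo t])⟩
  obtain ⟨hXc, hXd⟩ := key hX hXo
  obtain ⟨hYc, hYd⟩ := key hY hYo
  funext t
  have hT0 : (0 : ℝ) ∈ Ioo (-(|t| + 1)) (|t| + 1) := ⟨by linarith [abs_nonneg t], by positivity⟩
  have htT : t ∈ Ioo (-(|t| + 1)) (|t| + 1) :=
    ⟨by linarith [neg_abs_le t], by linarith [le_abs_self t]⟩
  obtain ⟨M, hM⟩ := isCompact_Icc.exists_bound_of_continuousOn
    (hU.continuousOn (s := Icc (-(|t| + 1)) (|t| + 1)))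
  obtain ⟨ρ₁, hρ₁⟩ := isCompact_Icc.exists_bound_of_continuousOn
    (hXc.continuousOn (s := Icc (-(|t| + 1)) (|t| + 1)))
  obtain ⟨ρ₂, hρ₂⟩ := isCompact_Icc.exists_bound_of_continuousOn
    (hYc.continuousOn (s := Icc (-(|t| + 1)) (|t| + 1)))
  obtain ⟨K, hK⟩ := lipschitz_field B A M (max ρ₁ ρ₂)
  have h := ODE_solution_unique_of_mem_Ioo
    (v := fun t (p : F × F) => (p.2, B p.2 (A p.1 + U t)))
    (s := fun _ => closedBall 0 (max ρ₁ ρ₂))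
    (fun τ hτ => hK (U τ) (hM τ (Ioo_subset_Icc_self hτ))) hT0
    (fun τ hτ => ⟨hXd τ, mem_closedBall_zero_iff.2
      ((hρ₁ τ (Ioo_subset_Icc_self hτ)).trans (le_max_left _ _))⟩)
    (fun τ hτ => ⟨hYd τ, mem_closedBall_zero_iff.2
      ((hρ₂ τ (Ioo_subset_Icc_self hτ)).trans (le_max_right _ _))⟩)
    (by simp only [h0, h0']) htT
  exact congrArg Prod.fst h

/-- Tools stub T5 (`stub_forcedShooting`): global solvability of the frozen-field filament ODE.
For every `η, α`, every CONTINUOUS forcing `U : ℝ → ℝ³` and Cauchy data `(P, e)` with `‖e‖ = 1`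
there is a `C²` curve `X : ℝ → ℝ³` with `X 0 = P`, `X′ 0 = e`, unit speed, solving
`X″ = η X′ × (½X − α e₃×X + U(t))` on all of `ℝ`; and it is unique among `C²` curves with the same
data solving the same equation. (Phase-space field `(w, η w × (A x + U t))` is locally Lipschitz,
continuous in `t`; `‖w‖ ≡ 1` is conserved (`⟪w × ·, w⟫ = 0`), so `‖X t‖ ≤ ‖P‖ + |t|` — global
existence from the a priori bound, tree `Literature.Analysis.ODE.exists_solution_of_apriori_bound`,
both time directions glued at `0`; uniqueness by Grönwall.) [folklore] -/
theorem stub_forcedShooting : ∀ (η α : ℝ) (U : ℝ → EuclideanSpace ℝ (Fin 3)) (P e : EuclideanSpace ℝ (Fin 3)), Continuous U → ‖e‖ = 1 → (∃ X : ℝ → EuclideanSpace ℝ (Fin 3), ContDiff ℝ 2 X ∧ X 0 = P ∧ deriv X 0 = e ∧ (∀ t, ‖deriv X t‖ = 1) ∧ ∀ t, iteratedDeriv 2 X t = η • Literature.Analysis.FluidPDE.cross (deriv X t) ((1 / 2 : ℝ) • X t - α • Literature.Analysis.FluidPDE.cross (EuclideanSpace.single (2 : Fin 3) (1 : ℝ))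 (X t) + U t)) ∧ (∀ X Y : ℝ → EuclideanSpace ℝ (Fin 3), ContDiff ℝ 2 X → ContDiff ℝ 2 Y → X 0 = P → Y 0 = P → deriv X 0 = e → deriv Y 0 = e → (∀ t, iteratedDeriv 2 X t = η • Literature.Analysis.FluidPDE.cross (deriv X t) ((1 / 2 : ℝ) • X t - α • Literature.Analysis.FluidPDE.cross (EuclideanSpace.single (2 : Fin 3) (1 : ℝ)) (X t) + U t)) → (∀ t, iteratedDeriv 2 Y t = η • Literature.Analysis.FluidPDE.cross (deriv Y t) ((1 / 2 : ℝ) • Y t - α • Literature.Analysis.FluidPDE.cross (EuclideanSpace.single (2 : Fin 3) (1 : ℝ)) (Y t) + U t)) → X = Y) := by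
  intro η α U P e hU he
  set A : EuclideanSpace ℝ (Fin 3) →L[ℝ] EuclideanSpace ℝ (Fin 3) :=
    (1 / 2 : ℝ) • ContinuousLinearMap.id ℝ (EuclideanSpace ℝ (Fin 3)) -
      α • crossCLM (EuclideanSpace.single (2 : Fin 3) (1 : ℝ)) with hAdef
  have hA : ∀ y, A y =
      (1 / 2 : ℝ) • y - α • cross (EuclideanSpace.single (2 : Fin 3) (1 : ℝ)) y :=
    fun y => by simp [hAdef]
  have hB : ∀ w v : EuclideanSpace ℝ (Fin 3), ⟪(η • crossCLM) w v, w⟫ = 0 := fun w v => by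
    simp only [_root_.smul_apply, crossCLM_apply, real_inner_smul_left, inner_cross_self_left,
      mul_zero]
  have h2 : ∀ Z : ℝ → EuclideanSpace ℝ (Fin 3), iteratedDeriv 2 Z = deriv (deriv Z) :=
    fun Z => by rw [iteratedDeriv_succ, iteratedDeriv_one]
  refine ⟨?_, fun X Y hX hY hX0 hY0 hXd hYd hXo hYo => ?_⟩
  · obtain ⟨γ, h0, hunit, hγ⟩ := exists_phase hB A hU P he
    obtain ⟨hC2, hd1, hdd⟩ := curve_of_phase hU hγ
    refine ⟨fun s => (γ s).1, hC2, by simp [h0], by rw [hd1]; simp [h0],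
      fun t => by rw [hd1]; exact hunit t, fun t => ?_⟩
    rw [h2, hdd]
    simp only [hd1, hA, _root_.smul_apply, crossCLM_apply]
  · exact unique_of_phase (B := η • crossCLM) hU hX hY (hX0.trans hY0.symm) (hXd.trans hYd.symm)
      (fun t => by rw [← h2, hXo t, hA, _root_.smul_apply, _root_.smul_apply, crossCLM_apply])
      (fun t => by rw [← h2, hYo t, hA, _root_.smul_apply, _root_.smul_apply, crossCLM_apply])

end Summit.NavierStokesRegularity.NavierStokesRegularity.Theorems.SkeletonEquilibrium.Sketch
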